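import Summits.AnomalousDissipation.AnomalousDissipation.Theorems.SolenoidalFractalHomogenisationLagrangianStepOneLevelSplitDefsW7
import Summits.AnomalousDissipation.AnomalousDissipation.Theorems.SolenoidalFractalHomogenisationLagrangianStepCellChainLinks
import HarnessLib

/-!
# K1L_D `LagrangianRenormalisationStepDesign` (stmt-AnomalousDissipation-27980), W7 engine: LATTICE GEOMETRY of the regime split and of the three-mode windows,
# and the `k̃`-SPLICE of `ClassDecayW` (helper; `--supports stmt-AnomalousDissipation-27980`)

Summits-side helper file of route `SolenoidalFractalHomogenisation` (prover seat `ad-k1l-cellLawV-w1` g4; inputs `hdisj`/`hgap` of the assembly owner's per-slot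
adapter and the far/near splice, STATUS 22:16:05Z).  Everything proved; no definitions, no named facts, no sorry.

* `latticeVec_intSMul`, `norm_latticeVec_ge_of_classPair_ne` — a mode of the class pair `(ℓ + nℤ³) ∪ (−ℓ + nℤ³)` other than `±ℓ` has
  `‖k‖ ≥ n − ‖ℓ‖` (so off the slow pair every carried mode is fast: the `dmin` gap of the three-mode engine);
* `windows_disjoint_of_two_norm_lt` — if `K₀ ≠ 0` and `2‖K₀‖ < ‖K_s‖` (e.g. `k̃ < 1/2`), the `+` and `−` five-windows `±(K₀ + jK_s)`, `|j| ≤ 2`, are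
  disjoint (hypothesis `hdisj` of `…CellChainPair` / `…CellChainSlotStepInputs`);
* `classDecayW_split_kt` — SPLICE in the ν-free label distance `k̃ = dist(ℓ, nℤ³)/n`: near classes (`∃ z, ‖ℓ + nz‖ < κn`) + far classes
  (`∀ z, κn ≤ ‖ℓ + nz‖`, served by `…CellChainBareDecay.classDecayW_bare`) give `admAll` with constants `max CK`, `min cK`, `min ν₀`.
NOT a proof of any registered stub, of the crux, or of anomalous dissipation; rung F-D1.A0 infrastructure.
-/

set_option linter.dupNamespace false

noncomputable section

namespace Summit.AnomalousDissipation.AnomalousDissipation.Theorems.SolenoidalFractalHomogenisation.LagrangianStep.CellChain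

open Set MeasureTheory Filter Topology Function
open scoped InnerProductSpace
open Literature.Analysis Literature.Analysis.FunctionSpaces Literature.Analysis.FunctionSpaces.Torus
open Literature.Analysis.FluidPDE Literature.Analysis.FluidPDE.Torus Literature.Analysis.FluidPDE.LatticeShear
open Summit.AnomalousDissipation.AnomalousDissipation.Theorems.SolenoidalFractalHomogenisation.LagrangianStep

/-! ## §1 Lattice geometry -/

/-- `latticeVec (c • z) = c • latticeVec z` for an integer scalar. [folklore] -/
theorem latticeVec_intSMul (c : ℤ) (z : Fin 3 → ℤ) : Torus.latticeVec (c • z) = (c : ℝ) • Torus.latticeVec z := by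
  ext a
  rw [Torus.latticeVec_apply, PiLp.smul_apply, Torus.latticeVec_apply, Pi.smul_apply, smul_eq_mul, smul_eq_mul, Int.cast_mul]

/-- **Off the slow pair every mode of the class pair is fast**: if `k'` lies in `(ℓ + nℤ³) ∪ (−ℓ + nℤ³)` and `k' ≠ ±ℓ`, then `n − ‖ℓ‖ ≤ ‖k'‖`. [folklore] -/
theorem norm_latticeVec_ge_of_classPair_ne {n : ℕ} {ℓ k' : Fin 3 → ℤ}
    (hk' : (∃ z : Fin 3 → ℤ, k' = ℓ + (n : ℤ) • z) ∨ (∃ z : Fin 3 → ℤ, k' = -ℓ + (n : ℤ) • z)) (h1 : k' ≠ ℓ) (h2 : k' ≠ -ℓ) :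
    (n : ℝ) - ‖Torus.latticeVec ℓ‖ ≤ ‖Torus.latticeVec k'‖ := by
  -- in either case `k' = ε ℓ + n • z` with `z ≠ 0`
  have key : ∀ (ℓ₀ : Fin 3 → ℤ) (z : Fin 3 → ℤ), z ≠ 0 → ‖Torus.latticeVec ℓ₀‖ = ‖Torus.latticeVec ℓ‖ →
      (n : ℝ) - ‖Torus.latticeVec ℓ‖ ≤ ‖Torus.latticeVec (ℓ₀ + (n : ℤ) • z)‖ := by
    intro ℓ₀ z hz hnorm
    have hz1 : 1 ≤ ‖Torus.latticeVec z‖ := Torus.one_le_norm_latticeVec hz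
    have hnz : ‖Torus.latticeVec ((n : ℤ) • z)‖ = (n : ℝ) * ‖Torus.latticeVec z‖ := by
      rw [latticeVec_intSMul, norm_smul, Int.cast_natCast, Real.norm_eq_abs, abs_of_nonneg (Nat.cast_nonneg n)]
    have htri : ‖Torus.latticeVec ((n : ℤ) • z)‖ - ‖Torus.latticeVec ℓ₀‖ ≤ ‖Torus.latticeVec (ℓ₀ + (n : ℤ) • z)‖ := by
      rw [Torus.latticeVec_add]
      have := norm_sub_norm_le (Torus.latticeVec ((n : ℤ) • z)) (-(Torus.latticeVec ℓ₀))
      rw [norm_neg, sub_neg_eq_add, add_comm] at this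
      linarith
    have hn : (n : ℝ) ≤ (n : ℝ) * ‖Torus.latticeVec z‖ := le_mul_of_one_le_right (Nat.cast_nonneg n) hz1
    linarith
  rcases hk' with ⟨z, rfl⟩ | ⟨z, rfl⟩
  · refine key ℓ z ?_ rfl
    rintro rfl
    exact h1 (by simp)
  · refine key (-ℓ) z ?_ (by rw [Torus.latticeVec_neg, norm_neg])
    rintro rfl
    exact h2 (by simp)

/-- **The `+` and `−` five-windows are disjoint** when `K₀ ≠ 0` and `2‖K₀‖ < ‖K_s‖`: `K₀ + jK_s ≠ −(K₀ + j'K_s)` for all `|j|, |j'| ≤ 2` (indeed all `j, j'`). [folklore] -/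
theorem windows_disjoint_of_two_norm_lt {K0 Ks : Fin 3 → ℤ} (hK0 : K0 ≠ 0) (hlt : 2 * ‖Torus.latticeVec K0‖ < ‖Torus.latticeVec Ks‖) (j j' : ℤ) :
    K0 + j • Ks ≠ -(K0 + j' • Ks) := by
  intro heq
  have h2 : (2 : ℤ) • K0 = (-(j + j')) • Ks := by
    have : K0 + j • Ks + (K0 + j' • Ks) = 0 := by rw [heq]; exact neg_add_cancel _
    rw [two_zsmul, neg_zsmul, add_zsmul]
    have e : K0 + K0 + (j • Ks + j' • Ks) = 0 := by rw [← this]; abel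
    exact eq_neg_of_add_eq_zero_left e
  by_cases hjj : j + j' = 0
  · rw [hjj, neg_zero, zero_zsmul] at h2
    have : K0 = 0 := by
      have h3 : (2 : ℤ) • K0 = 0 := h2
      rcases smul_eq_zero.1 h3 with h | h
      · norm_num at h
      · exact h
    exact hK0 this
  · have hnorm := congrArg (fun v => ‖Torus.latticeVec v‖) h2
    simp only [latticeVec_intSMul, norm_smul] at hnorm
    rw [Int.cast_neg, norm_neg, Real.norm_eq_abs, Real.norm_eq_abs] at hnorm
    have hj1 : (1 : ℝ) ≤ |((j + j' : ℤ) : ℝ)| := by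
      rw [← Int.cast_abs]
      exact_mod_cast Int.one_le_abs hjj
    have h0 : 0 ≤ ‖Torus.latticeVec Ks‖ := norm_nonneg _
    have : ‖Torus.latticeVec Ks‖ ≤ |((j + j' : ℤ) : ℝ)| * ‖Torus.latticeVec Ks‖ := le_mul_of_one_le_left h0 hj1
    have h22 : |(2:ℝ)| = 2 := abs_of_pos two_pos
    rw [Int.cast_ofNat, h22] at hnorm
    push_cast at this hnorm
    linarith

/-! ## §2 The `k̃`-splice of `ClassDecayW` -/

/-- **SPLICE in the ν-free label distance**: near classes (`∃ z, ‖ℓ + nz‖ < κn`) and far classes (`∀ z, κn ≤ ‖ℓ + nz‖`) together give all classes, with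
constants `max CK`, `min cK`, `min ν₀` (same bookkeeping as `classDecayW_split`). [cite: BedrossianCotiZelati2017, Thm 1.1 — bookkeeping of this route's W7 clause] -/
theorem classDecayW_split_kt {k : ℕ} {W : LatticeWord k} {M : ℝ} {hM : 0 < M} {lo hi Λ β ν₁ ν₂ Kb CK₁ CK₂ cK₁ cK₂ : ℝ}
    (κ : ℝ) (hCK₁ : 0 ≤ CK₁)
    (h₁ : ClassDecayW W M hM lo hi Λ β ν₁ Kb CK₁ cK₁ (fun n _ ℓ => ∃ z : Fin 3 → ℤ, ‖Torus.latticeVec (ℓ + (n : ℤ) • z)‖ < κ * n))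
    (h₂ : ClassDecayW W M hM lo hi Λ β ν₂ Kb CK₂ cK₂ (fun n _ ℓ => ∀ z : Fin 3 → ℤ, κ * n ≤ ‖Torus.latticeVec (ℓ + (n : ℤ) • z)‖)) :
    ClassDecayW W M hM lo hi Λ β (min ν₁ ν₂) Kb (max CK₁ CK₂) (min cK₁ cK₂) admAll := by
  intro ν hν n hn 𝔸 hodd hwin L hL hKL ℓ hdist _ F hF hsupp T hT u hu
  have hCK0 : 0 ≤ max CK₁ CK₂ := le_max_of_le_left hCK₁
  by_cases hc : ∃ z : Fin 3 → ℤ, ‖Torus.latticeVec (ℓ + (n : ℤ) • z)‖ < κ * n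
  · have h₁' := classDecayW_mono (adm' := fun n _ ℓ => ∃ z : Fin 3 → ℤ, ‖Torus.latticeVec (ℓ + (n : ℤ) • z)‖ < κ * n)
      (min_le_left ν₁ ν₂) (le_max_left CK₁ CK₂) (min_le_left cK₁ cK₂) hCK0 (fun _ _ _ h => h) h₁
    exact h₁' ν hν n hn 𝔸 hodd hwin L hL hKL ℓ hdist hc F hF hsupp T hT u hu
  · have hfar : ∀ z : Fin 3 → ℤ, κ * n ≤ ‖Torus.latticeVec (ℓ + (n : ℤ) • z)‖ := by
      intro z
      by_contra hz
      exact hc ⟨z, not_le.mp hz⟩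
    have h₂' := classDecayW_mono (adm' := fun n _ ℓ => ∀ z : Fin 3 → ℤ, κ * n ≤ ‖Torus.latticeVec (ℓ + (n : ℤ) • z)‖)
      (min_le_right ν₁ ν₂) (le_max_right CK₁ CK₂) (min_le_right cK₁ cK₂) hCK0 (fun _ _ _ h => h) h₂
    exact h₂' ν hν n hn 𝔸 hodd hwin L hL hKL ℓ hdist hfar F hF hsupp T hT u hu

end Summit.AnomalousDissipation.AnomalousDissipation.Theorems.SolenoidalFractalHomogenisation.LagrangianStep.CellChain

end
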